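import Summits.QuantumFields.YangMills.Theses.ThermodynamicCeilings
import Summits.QuantumFields.YangMills.Theorems.ThermodynamicCeilingsAbelAnchoredTransfer
import Literature.MathematicalPhysics.QuantumFieldTheory.PlaquetteSpectralMeasure
import HarnessLib

/-!
# (Part 1 of 2 — LANDING SPLIT) Currency of LINES «CanonicalSpectralClauses» (g16-1, crux ⟨stmt-QuantumFields-28158⟩) and «SpectralAnchor»
# (g16-2, crux ⟨stmt-QuantumFields-27770⟩): §0 hypothesis blocks, §1 canonical witness + clause shapes, §2 `canonical_representation`

Author: planner ym-idea-11 g16 (file `ideators/ym-idea-11/g16/landing/ThermodynamicCeilingsCanonicalSpectralDefs.lean`, sha16 afdaf23bcaa066a4).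
Landed as a landing service by lead seat `ym-line-sfw-p2` g75 (cell ym-idea-1).  The gate's 400-line rule for Theorems files with proofs forces a
SPLIT of the 465-line module into two files; this is the first namespace (`…AnchoredSpectralMeasure.CanonicalSpectralClauses`) BYTE-IDENTICAL
(plus two one-line docstrings the lint requires); the second namespace (`…TopBandPointCeiling.SpectralAnchor`, §3–§4) is the module
`ThermodynamicCeilingsCanonicalSpectralDefs`, which imports this one — so `import …ThermodynamicCeilingsCanonicalSpectralDefs` (the planner's
import-swap skeletons g16/rev4, g16/rev5) still provides EVERY constant of the original module.  The author's header follows unchanged.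
HONEST LABEL: currency + glue; no crux, rung, leaf or summit statement is proved; the Yang–Mills mass gap is NOT proved.
-/


/-!
# Currency + analysis module of LINES «CanonicalSpectralClauses» (g16-1, crux ⟨stmt-QuantumFields-28158⟩
# `ThermodynamicCeilings.AnchoredSpectralMeasure`, skeleton 3fb89ed6) and «SpectralAnchor» (g16-2, crux
# ⟨stmt-QuantumFields-27770⟩ `ThermodynamicCeilings.TopBandPointCeiling`, skeleton REV 3) — planner ym-idea-11 g16;
# critic idea-crit-9 VERDICT #87 P3 / VERDICT #88 P3–P4 («land ONE shared sorry-free support module; both Lines files import it»).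

This file is the sorry-free part of the two REGISTERED skeletons `ideators/ym-idea-11/g16/canonical-spectral-clauses.lean` and
`ideators/ym-idea-11/g16/spectral-anchor.lean`, CHARACTER-FOR-CHARACTER and in the SAME namespaces
`Summit.QuantumFields.YangMills.Cruxes.AnchoredSpectralMeasure.CanonicalSpectralClauses` /
`Summit.QuantumFields.YangMills.Cruxes.TopBandPointCeiling.SpectralAnchor`, so that every stub landing
(`stub_anchoredMajorant`, `stub_laplaceUV` — ∀L form registered on 28158, C″ form `2ℓ ≤ s·L` registered on 27770 — and
`stub_spectralAnchor` on 27770) and both skeletons import ONE set of constants (no FQN re-declaration across tree files):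

* §0 the hypothesis blocks `Floors`, `OnsetMax` (28158 / 27770 verbatim), `NearOnset` (27770 verbatim);
* §1 the CANONICAL WITNESS `canMeasure` / `canConstant` := Literature `plaquetteSpectralMeasure` / `plaquetteSpectralConstant` of
  `r.ρ` on the odd torus `2L+1`, axis `k` moved to slot 0; the clause shapes `Majorant`, `LaplaceUV` (+ monotonicity in `A`);
* §2 PROVED: `canonical_representation` — clause (i) of 28158 for the canonical witness (finite, supported in (0,∞), κ₀ ≥ 0, and
  the reflected Laplace representation of the on-axis mirror covariance for 2 ≤ t ≤ 2L−1), from the landed Literature theorem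
  `plaquette_pair_spectral_representation`;
* §3 PROVED (pure real analysis): `laplace_anchor_upper` / `representation_anchor_upper` — ∫ e^{−Eτ} dν ≤ (1 + 2A·16⁸ + A²8⁸e²)·ν([0,x₀))
  for a finite measure on (0,∞) with the one-anchor degree-8 majorant on [x₀,1] and the Laplace-UV clause, whenever τ ≥ 3, x₀τ ≥ 1
  (layer cake + `majorant_restrict`, `pow_eight_le_exp_half`, `pow_eight_exp_le`, `lintegral_exp_neg_log_half`); `anchorConst`, `anchor_arith`;
* §4 PROVED: the «wuc certificate» `spectralAnchor_of_topBandPointCeiling` — `TopBandPointCeiling` (27770) implies the spectral IR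
  anchor S1 (κ₀ + ν_can([0,E₀)) ≤ (e^{3/2}C/R₂⁴)², E₀ = max(s/ℓ, 4/L)) under 27770's own hypotheses (necessity half: a refutation of
  S1 refutes 27770 — negative-knowledge routing).

Author: planner ym-idea-11 g16 (to be landed unchanged as a landing service, pattern ✓p711383).  HONEST LABEL: currency +
glue/analysis lemmas; no crux, rung, leaf or summit statement is proved by this file; the Yang–Mills mass gap is NOT proved.

References: Montvay–Münster (1994) §1.5.2, §3.5 [MontvayMunster1994]; Osterwalder–Seiler 1978 §3 [OsterwalderSeiler1978];
Lüscher 1977 [Luscher1977]; Glimm–Jaffe 1987 §6.1 [GlimmJaffe1987].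
-/

set_option autoImplicit false


noncomputable section

open MeasureTheory Filter Topology
open Literature.MathematicalPhysics.QuantumFieldTheory Literature.MathematicalPhysics.QuantumLattice
open Summit.QuantumFields.YangMills.Cruxes.OSLegsFromFemtoAndGap.DlrCollarTransfer

namespace Summit.QuantumFields.YangMills.Cruxes.AnchoredSpectralMeasure.CanonicalSpectralClauses

section Defs

variable (G : Type) [Group G] [TopologicalSpace G] [IsTopologicalGroup G] [CompactSpace G]
  [MeasurableSpace G] [BorelSpace G]

/-- The joint torus floors of level `ε` for the datum `(r, v, f, g, h, Λ₅)` — the hypothesis block of 28158 VERBATIM. -/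
def Floors (r : LatticeRep G) (v f g h : SchwartzMap (EuclideanSpace ℝ (Fin 4)) ℝ) (Λ₅ ε : ℝ) : Prop :=
  ∃ β₅ : ℝ, ∀ β : ℝ, β₅ ≤ β → ∃ s : ℝ, 0 < s ∧ s ≤ 1 ∧
    (∀ L : ℕ, Λ₅ ≤ s * L → ε ≤ Q2 G r β L s (thetaTest 4 v) v) ∧ (∀ L : ℕ, Λ₅ ≤ s * L → ε ≤ |Q3 G r β L s f g h|)

/-- Onset maximality of the scale `s` at `β` (no joint floor of level `ε` at any `s' ∈ [2s, 1]`) — VERBATIM from 28158. -/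
def OnsetMax (r : LatticeRep G) (v f g h : SchwartzMap (EuclideanSpace ℝ (Fin 4)) ℝ) (Λ₅ ε β s : ℝ) : Prop :=
  ∀ s' : ℝ, 2 * s ≤ s' → s' ≤ 1 → ¬ ((∀ L : ℕ, Λ₅ ≤ s' * L → ε ≤ Q2 G r β L s' (thetaTest 4 v) v) ∧
    (∀ L : ℕ, Λ₅ ≤ s' * L → ε ≤ |Q3 G r β L s' f g h|))

/-- Near-onset resolution (a joint floor of level `ε` at some `s'' ∈ [s/4, 1]`) — the extra hypothesis block of 27770 VERBATIM
(kept next to `Floors`/`OnsetMax`, idea-crit-9 #88 P4). -/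
def NearOnset (r : LatticeRep G) (v f g h : SchwartzMap (EuclideanSpace ℝ (Fin 4)) ℝ) (Λ₅ ε β s : ℝ) : Prop :=
  ∃ s'' : ℝ, s / 4 ≤ s'' ∧ s'' ≤ 1 ∧ ((∀ L : ℕ, Λ₅ ≤ s'' * L → ε ≤ Q2 G r β L s'' (thetaTest 4 v) v) ∧
    (∀ L : ℕ, Λ₅ ≤ s'' * L → ε ≤ |Q3 G r β L s'' f g h|))

/-- **The canonical witness**: the plaquette-channel spectral measure of the Wilson transfer matrix on `(ℤ/(2L+1))⁴`, read
along the axis `k` (transposition `0 ↔ k` of the orientation), Literature `plaquetteSpectralMeasure`. -/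
def canMeasure (r : LatticeRep G) (β : ℝ) (L : ℕ) (q : Fin 4 × Fin 4) (k : Fin 4) : Measure ℝ := by
  haveI : SecondCountableTopology G :=
    (r.continuous.isClosedEmbedding r.injective).isEmbedding.secondCountableTopology
  exact plaquetteSpectralMeasure r.ρ β (2 * L + 1) (Equiv.swap 0 k q.1) (Equiv.swap 0 k q.2)

/-- **The canonical constant** `κ₀` (degenerate pairs minus the disconnected part), Literature `plaquetteSpectralConstant`. -/
def canConstant (r : LatticeRep G) (β : ℝ) (L : ℕ) (q : Fin 4 × Fin 4) (k : Fin 4) : ℝ := by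
  haveI : SecondCountableTopology G :=
    (r.continuous.isClosedEmbedding r.injective).isEmbedding.secondCountableTopology
  exact plaquetteSpectralConstant r.ρ β (2 * L + 1) (Equiv.swap 0 k q.1) (Equiv.swap 0 k q.2)

end Defs

/-- Clause (ii_a) of 28158 for a given measure: the one-anchor degree-8 majorant on `[E₀, 1]`. -/
def Majorant (ν : Measure ℝ) (A E₀ : ℝ) : Prop :=
  ∀ E : ℝ, E₀ ≤ E → E ≤ 1 → (ν (Set.Iio E)).toReal ≤ A * (E / E₀) ^ 8 * (ν (Set.Iio E₀)).toReal

/-- Clause (iii) of 28158 for a given measure: the Laplace-UV bound at the cutoff. -/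
def LaplaceUV (ν : Measure ℝ) (A E₀ : ℝ) : Prop :=
  E₀ ≤ 1 → (∫ E in Set.Ici (1 : ℝ), Real.exp (-(2 * E)) ∂ν) ≤ A * (ν (Set.Iio 1)).toReal

/-- Monotonicity of the majorant clause in the constant `A`. -/
theorem Majorant.mono {ν : Measure ℝ} {A A' E₀ : ℝ} (h : Majorant ν A E₀) (hA : A ≤ A') :
    Majorant ν A' E₀ := by
  intro E hE hE1
  refine le_trans (h E hE hE1) ?_
  have h1 : 0 ≤ (E / E₀) ^ 8 * (ν (Set.Iio E₀)).toReal := by positivity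
  nlinarith

/-- Monotonicity of the Laplace-UV clause in the constant `A`. -/
theorem LaplaceUV.mono {ν : Measure ℝ} {A A' E₀ : ℝ} (h : LaplaceUV ν A E₀) (hA : A ≤ A') :
    LaplaceUV ν A' E₀ := by
  intro hE
  refine le_trans (h hE) ?_
  have h1 : 0 ≤ (ν (Set.Iio 1)).toReal := ENNReal.toReal_nonneg
  nlinarith

/-! ## The proved clause: representation + side conditions for the canonical witness -/

/-- **Clause (i) of 28158 and its side conditions hold for the canonical witness** (`δ = 1`), for every compact `G`, every
lattice representation `r`, every `β ≥ 0`, every odd torus `2L+1`, orientation `q` and axis `k`: the Literature theorem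
`plaquette_pair_spectral_representation` in the route's letters (`torusE`, `plane` unfold definitionally).
[cite: MontvayMunster1994, §1.5.2 (1.195)–(1.199)] [cite: OsterwalderSeiler1978, §3] [cite: Luscher1977] -/
theorem canonical_representation (G : Type) [Group G] [TopologicalSpace G] [IsTopologicalGroup G] [CompactSpace G]
    [MeasurableSpace G] [BorelSpace G] (r : LatticeRep G) (β : ℝ) (hβ : 0 ≤ β) (L : ℕ) (q : Fin 4 × Fin 4) (k : Fin 4) :
    IsFiniteMeasure (canMeasure G r β L q k) ∧ canMeasure G r β L q k (Set.Iic 0) = 0 ∧ 0 ≤ canConstant G r β L q k ∧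
    (∀ t : ℕ, 2 ≤ t → t + 2 ≤ 2 * L + 1 →
      torusE G r β L (fun U => (plane G r q (fun i => if i = k then (t : ℤ) else 0) U -
          torusE G r β L (plane G r q (fun i => if i = k then (t : ℤ) else 0))) *
        (plane G r q (fun _ => 0) U - torusE G r β L (plane G r q (fun _ => 0)))) =
      canConstant G r β L q k + ∫ E, (Real.exp (-(E * ((t : ℝ) - ((1 : ℕ) : ℝ)))) +
        Real.exp (-(E * (((2 * L + 1 : ℕ) : ℝ) - ((1 : ℕ) : ℝ) - (t : ℝ))))) ∂(canMeasure G r β L q k)) := by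
  haveI : SecondCountableTopology G :=
    (r.continuous.isClosedEmbedding r.injective).isEmbedding.secondCountableTopology
  refine ⟨by unfold canMeasure; exact isFiniteMeasure_plaquetteSpectralMeasure _ _,
    by unfold canMeasure; exact plaquetteSpectralMeasure_Iic_zero _ _,
    by unfold canConstant; exact plaquetteSpectralConstant_nonneg _ _, ?_⟩
  intro t ht htN
  have hN : 5 ≤ 2 * L + 1 := by omega
  have h := plaquette_pair_spectral_representation (N := 2 * L + 1) (ρ := r.ρ) (β := β)
    r.continuous r.mem_unitary hβ k q.1 q.2 t ht htN hN
  simp only [Nat.cast_one]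
  exact h

end Summit.QuantumFields.YangMills.Cruxes.AnchoredSpectralMeasure.CanonicalSpectralClauses

end
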